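import Literature.Computability.Complexity.Williams2014ConvCap
import Literature.Computability.Complexity.CodeFPBudgets
import HarnessLib

/-!
# Quasi-polynomial bounds for the genuine run of the `ACC → SYM⁺` conversion

R. Williams, *Nonuniform ACC circuit lower bounds*, J. ACM 61 (2014), Lemma 4.1 / Appendix A: the
conversion runs in time `s^{O(log^{f(d)} s)}` because every intermediate object — the `2^{poly(log s)}`
copies, the quasi-polynomially long token strings of the collapsed formula, the monomial expansion —
is quasi-polynomially large. This file proves exactly these size bounds for the explicit objects of
`Williams2014Collapse.lean` / `Williams2014ConvCode.lean` and concludes the hypothesis `CapFits` of the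
budget lemma (`Williams2014ConvCap.lean`) from one inequality `2^{(log₂ X + 2)^E} ≤ B` on the budget,
`X` the length of the circuit code:

* a small calculus of bounds `x ≤ 2^{L^e}` (`qp_add`, `qp_mul`, …);
* the syntactic size of formulas (`AForm.size = |rpn|`) and its growth under the connectives,
  substitution and modulus amplification; constants (`AForm.CstIn`) and subformulas (`AForm.Sub`);
  the stacks of the expansion hold expansions of subformulas (`runToks_prefix`); coefficients are
  bounded by the weight (`natAbs_le_wt_of_mem_expand`);
* the invariants of the genuine run: variables of copy `< T` (`varsIn_copy_Rk`), constants of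
  absolute value `≤ 3`;
* the bounds of the fields of `CapFits` and **`capFits_of_le`**.

No new named fact; everything is proved.

## References

* R. Williams, *Nonuniform ACC circuit lower bounds*, J. ACM 61 (2014), Lemma 4.1, Appendix A
  [Williams2014].
-/

namespace Literature.Computability.Complexity

open Finset SatCode GateList CodeFP Brick

/-! ### A calculus of quasi-polynomial bounds -/

namespace BT

section qp

variable {L : ℕ} (hL : 2 ≤ L)
include hL

/-- `L^e ≥ 1`. [folklore] -/
theorem one_le_Lpow (e : ℕ) : 1 ≤ L ^ e := Nat.one_le_pow _ _ (by omega)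

/-- Monotonicity in the exponent. [folklore] -/
theorem qp_mono {x e e' : ℕ} (h : x ≤ 2 ^ L ^ e) (he : e ≤ e') : x ≤ 2 ^ L ^ e' :=
  h.trans (Nat.pow_le_pow_right two_pos (Nat.pow_le_pow_right (by omega) he))

/-- `L^e + L^e ≤ L^{e+1}`. [folklore] -/
theorem Lpow_add_Lpow_le (e : ℕ) : L ^ e + L ^ e ≤ L ^ (e + 1) := by
  rw [pow_succ]; nlinarith [one_le_Lpow hL e]

/-- Sums. [folklore] -/
theorem qp_add {x y e : ℕ} (hx : x ≤ 2 ^ L ^ e) (hy : y ≤ 2 ^ L ^ e) : x + y ≤ 2 ^ L ^ (e + 1) :=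
  calc x + y ≤ 2 ^ L ^ e + 2 ^ L ^ e := add_le_add hx hy
    _ = 2 ^ (L ^ e + 1) := by rw [pow_succ]; ring
    _ ≤ 2 ^ L ^ (e + 1) := Nat.pow_le_pow_right two_pos (by
        have := Lpow_add_Lpow_le hL e; have := one_le_Lpow hL e; omega)

/-- Products. [folklore] -/
theorem qp_mul {x y e : ℕ} (hx : x ≤ 2 ^ L ^ e) (hy : y ≤ 2 ^ L ^ e) : x * y ≤ 2 ^ L ^ (e + 1) :=
  calc x * y ≤ 2 ^ L ^ e * 2 ^ L ^ e := Nat.mul_le_mul hx hy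
    _ = 2 ^ (L ^ e + L ^ e) := by rw [← pow_add]
    _ ≤ 2 ^ L ^ (e + 1) := Nat.pow_le_pow_right two_pos (Lpow_add_Lpow_le hL e)

/-- `r ≤ L^r`. [folklore] -/
theorem le_Lpow_self (r : ℕ) : r ≤ L ^ r := (Nat.lt_two_pow_self).le.trans (Nat.pow_le_pow_left hL r)

/-- Powers with a fixed exponent. [folklore] -/
theorem qp_pow {x e : ℕ} (hx : x ≤ 2 ^ L ^ e) (r : ℕ) : x ^ r ≤ 2 ^ L ^ (e + r) :=
  calc x ^ r ≤ (2 ^ L ^ e) ^ r := Nat.pow_le_pow_left hx r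
    _ = 2 ^ (L ^ e * r) := by rw [← pow_mul]
    _ ≤ 2 ^ L ^ (e + r) := Nat.pow_le_pow_right two_pos (by
        rw [pow_add]; exact Nat.mul_le_mul_left _ (le_Lpow_self hL r))

omit hL in
/-- Polynomially bounded quantities. [folklore] -/
theorem qp_of_le_Lpow {x r : ℕ} (hx : x ≤ L ^ r) : x ≤ 2 ^ L ^ r := hx.trans (Nat.lt_two_pow_self).le

/-- Constants. [folklore] -/
theorem qp_const (c : ℕ) : c ≤ 2 ^ L ^ c := qp_of_le_Lpow (le_Lpow_self hL c)

omit hL in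
/-- Exponentials of polynomially bounded quantities. [folklore] -/
theorem qp_two_pow {x r : ℕ} (hx : x ≤ L ^ r) : 2 ^ x ≤ 2 ^ L ^ r := Nat.pow_le_pow_right two_pos hx

/-- `c · L^r ≤ L^{r+c}`. [folklore] -/
theorem const_mul_Lpow_le (c r : ℕ) : c * L ^ r ≤ L ^ (r + c) := by
  rw [pow_add, mul_comm]; exact Nat.mul_le_mul_left _ (le_Lpow_self hL c)

/-- `L^i + L^j ≤ L^{max i j + 1}`. [folklore] -/
theorem Lpow_add_le (i j : ℕ) : L ^ i + L ^ j ≤ L ^ (max i j + 1) :=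
  (add_le_add (Nat.pow_le_pow_right (by omega) (le_max_left i j))
    (Nat.pow_le_pow_right (by omega) (le_max_right i j))).trans (Lpow_add_Lpow_le hL _)

end qp

end BT

/-! ### Syntactic size, constants and subformulas of formulas -/

namespace AForm

variable {σ σ' : Type*}

/-- The number of nodes of a formula (the length of its postfix string). [folklore] -/
def size : AForm σ → ℕ
  | var _ => 1
  | cst _ => 1
  | add F G => F.size + G.size + 1
  | mul F G => F.size + G.size + 1

/-- Sizes are positive. [folklore] -/
theorem one_le_size : ∀ F : AForm σ, 1 ≤ F.size
  | var _ => le_rfl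
  | cst _ => le_rfl
  | add _ _ => Nat.le_add_left 1 _
  | mul _ _ => Nat.le_add_left 1 _

/-- Size of `1 - F`. [folklore] -/
@[simp] theorem size_oneSub (F : AForm σ) : F.oneSub.size = F.size + 4 := by
  simp [oneSub, neg, size]; omega

/-- Size of a list sum. [folklore] -/
theorem size_sumL : ∀ l : List (AForm σ), (sumL l).size = (l.map size).sum + l.length + 1
  | [] => rfl
  | F :: l => by rw [sumL, size, size_sumL l]; simp; omega

/-- Size of a list product. [folklore] -/
theorem size_prodL : ∀ l : List (AForm σ), (prodL l).size = (l.map size).sum + l.length + 1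
  | [] => rfl
  | F :: l => by rw [prodL, size, size_prodL l]; simp; omega

/-- Size of a list sum, uniform bound. [folklore] -/
theorem size_sumL_le {S : ℕ} {l : List (AForm σ)} (h : ∀ F ∈ l, F.size ≤ S) : (sumL l).size ≤ l.length * (S + 1) + 1 := by
  rw [size_sumL, Nat.mul_succ]
  have := List.sum_le_card_nsmul (l.map size) S (fun x hx => by
    obtain ⟨F, hF, rfl⟩ := List.mem_map.1 hx; exact h F hF)
  rw [List.length_map, smul_eq_mul] at this
  omega

/-- Size of a list product, uniform bound. [folklore] -/
theorem size_prodL_le {S : ℕ} {l : List (AForm σ)} (h : ∀ F ∈ l, F.size ≤ S) : (prodL l).size ≤ l.length * (S + 1) + 1 := by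
  rw [size_prodL, Nat.mul_succ]
  have := List.sum_le_card_nsmul (l.map size) S (fun x hx => by
    obtain ⟨F, hF, rfl⟩ := List.mem_map.1 hx; exact h F hF)
  rw [List.length_map, smul_eq_mul] at this
  omega

/-- Size of a power. [folklore] -/
theorem size_pow (F : AForm σ) (e : ℕ) : (F.pow e).size = e * (F.size + 1) + 1 := by
  rw [pow, size_prodL, List.map_replicate, List.sum_replicate, List.length_replicate, smul_eq_mul]; ring

/-- Size of the amplification step. [folklore] -/
theorem size_toda (F : AForm σ) : F.toda.size + 2 = 5 * (F.size + 2) := by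
  simp [toda, size]; ring

/-- Size of the iterated amplification. [folklore] -/
theorem size_todaIter (F : AForm σ) : ∀ κ, (todaIter κ F).size + 2 = 5 ^ κ * (F.size + 2)
  | 0 => by simp [todaIter]
  | κ + 1 => by rw [todaIter, size_toda, size_todaIter F κ, pow_succ]; ring

/-- Size of a substitution instance. [folklore] -/
theorem size_subst_le {τ : σ → AForm σ'} {M : ℕ} (hM : 1 ≤ M) (hτ : ∀ v, (τ v).size ≤ M) :
    ∀ F : AForm σ, (F.subst τ).size ≤ F.size * M
  | var v => by simpa [subst, size] using hτ v
  | cst _ => by simpa [subst, size] using hM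
  | add F G => by
    simp only [subst, size, Nat.add_mul, one_mul]
    have := size_subst_le hM hτ F; have := size_subst_le hM hτ G; omega
  | mul F G => by
    simp only [subst, size, Nat.add_mul, one_mul]
    have := size_subst_le hM hτ F; have := size_subst_le hM hτ G; omega

/-- All constants of `F` satisfy `Q`. [folklore] -/
def CstIn (Q : ℤ → Prop) : AForm σ → Prop
  | var _ => True
  | cst c => Q c
  | add F G => F.CstIn Q ∧ G.CstIn Q
  | mul F G => F.CstIn Q ∧ G.CstIn Q

/-- Constants of `1 - F`. [folklore] -/
theorem CstIn.oneSub {Q : ℤ → Prop} (h1 : Q 1) (hm1 : Q (-1)) {F : AForm σ} (h : F.CstIn Q) : F.oneSub.CstIn Q :=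
  ⟨h1, hm1, h⟩

/-- Constants of a list sum. [folklore] -/
theorem CstIn_sumL {Q : ℤ → Prop} (h0 : Q 0) : ∀ {l : List (AForm σ)}, (∀ F ∈ l, F.CstIn Q) → (sumL l).CstIn Q
  | [], _ => h0
  | F :: l, h => ⟨h F (by simp), CstIn_sumL h0 fun G hG => h G (by simp [hG])⟩

/-- Constants of a list product. [folklore] -/
theorem CstIn_prodL {Q : ℤ → Prop} (h1 : Q 1) : ∀ {l : List (AForm σ)}, (∀ F ∈ l, F.CstIn Q) → (prodL l).CstIn Q
  | [], _ => h1
  | F :: l, h => ⟨h F (by simp), CstIn_prodL h1 fun G hG => h G (by simp [hG])⟩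

/-- Constants of a power. [folklore] -/
theorem CstIn.pow {Q : ℤ → Prop} (h1 : Q 1) {F : AForm σ} (h : F.CstIn Q) (e : ℕ) : (F.pow e).CstIn Q :=
  CstIn_prodL h1 fun G hG => by obtain ⟨-, rfl⟩ := List.mem_replicate.1 hG; exact h

/-- Constants of the amplification step. [folklore] -/
theorem CstIn.toda {Q : ℤ → Prop} (h3 : Q 3) (hm2 : Q (-2)) {F : AForm σ} (h : F.CstIn Q) : F.toda.CstIn Q :=
  ⟨⟨h3, h, h⟩, hm2, h, h, h⟩

/-- Constants of the iterated amplification. [folklore] -/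
theorem CstIn.todaIter {Q : ℤ → Prop} (h3 : Q 3) (hm2 : Q (-2)) {F : AForm σ} (h : F.CstIn Q) :
    ∀ κ, (todaIter κ F).CstIn Q
  | 0 => h
  | κ + 1 => (CstIn.todaIter h3 hm2 h κ).toda h3 hm2

/-- Constants of a substitution instance. [folklore] -/
theorem CstIn_subst {Q : ℤ → Prop} {τ : σ → AForm σ'} (hτ : ∀ v, (τ v).CstIn Q) :
    ∀ {F : AForm σ}, F.CstIn Q → (F.subst τ).CstIn Q
  | var v, _ => hτ v
  | cst _, h => h
  | add _ _, h => ⟨CstIn_subst hτ h.1, CstIn_subst hτ h.2⟩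
  | mul _ _, h => ⟨CstIn_subst hτ h.1, CstIn_subst hτ h.2⟩

/-- Constants of a collapse substitution. [folklore] -/
theorem CstIn_collapseSubst {Q : ℤ → Prop} (h3 : Q 3) (hm2 : Q (-2)) (h1 : Q 1) {B : σ → Prop} [DecidablePred B]
    {F : σ → AForm σ} (hF : ∀ v, (F v).CstIn Q) (p κ : ℕ) (v : σ) : (collapseSubst B F p κ v).CstIn Q := by
  unfold collapseSubst
  split_ifs
  · exact ((hF v).pow h1 _).todaIter h3 hm2 _
  · trivial

/-- Size of a collapse substitution. [folklore] -/
theorem size_collapseSubst_le {B : σ → Prop} [DecidablePred B] {F : σ → AForm σ} {p κ S : ℕ}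
    (hF : ∀ v, (F v).size ≤ S) (v : σ) : (collapseSubst B F p κ v).size + 2 ≤ 5 ^ κ * ((p - 1) * (S + 1) + 3) := by
  unfold collapseSubst
  split_ifs
  · rw [size_todaIter, size_pow]
    have h1 : (p - 1) * ((F v).size + 1) ≤ (p - 1) * (S + 1) := Nat.mul_le_mul_left _ (Nat.succ_le_succ (hF v))
    exact Nat.mul_le_mul_left _ (by omega)
  · show 1 * 3 ≤ _
    exact Nat.mul_le_mul (Nat.one_le_pow _ _ (by norm_num)) (Nat.le_add_left 3 _)

/-- Variables of a collapse substitution, pointwise form. [folklore] -/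
theorem VarsIn_collapseSubst' {B : σ → Prop} [DecidablePred B] {F : σ → AForm σ} {p κ : ℕ} {Q : σ → Prop}
    (v : σ) (hF : B v → (F v).VarsIn Q) (hv : Q v) : (collapseSubst B F p κ v).VarsIn Q := by
  unfold collapseSubst
  split_ifs with hB
  · exact ((hF hB).pow _).todaIter κ
  · exact hv

/-- Conjunction of variable predicates. [folklore] -/
theorem VarsIn_and {P Q : σ → Prop} : ∀ {F : AForm σ}, F.VarsIn P → F.VarsIn Q → F.VarsIn (fun v => P v ∧ Q v)
  | var _, hP, hQ => ⟨hP, hQ⟩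
  | cst _, _, _ => trivial
  | add _ _, hP, hQ => ⟨VarsIn_and hP.1 hQ.1, VarsIn_and hP.2 hQ.2⟩
  | mul _ _, hP, hQ => ⟨VarsIn_and hP.1 hQ.1, VarsIn_and hP.2 hQ.2⟩

/-- `Sub G F`: `G` is a subformula of `F` (reflexive). [folklore] -/
inductive Sub : AForm σ → AForm σ → Prop
  | refl (F : AForm σ) : Sub F F
  | addL {G F H : AForm σ} : Sub G F → Sub G (add F H)
  | addR {G F H : AForm σ} : Sub G H → Sub G (add F H)
  | mulL {G F H : AForm σ} : Sub G F → Sub G (mul F H)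
  | mulR {G F H : AForm σ} : Sub G H → Sub G (mul F H)

/-- Subformulas have smaller weight. [folklore] -/
theorem Sub.wt_le {G F : AForm σ} (h : Sub G F) : G.wt ≤ F.wt := by
  induction h with
  | refl => exact le_rfl
  | addL _ ih => exact ih.trans (Nat.le_add_right _ _)
  | addR _ ih => exact ih.trans (Nat.le_add_left _ _)
  | mulL _ ih => exact ih.trans (Nat.le_mul_of_pos_right _ (one_le_wt _))
  | mulR _ ih => exact ih.trans (Nat.le_mul_of_pos_left _ (one_le_wt _))

/-- Subformulas have smaller degree. [folklore] -/
theorem Sub.deg_le {G F : AForm σ} (h : Sub G F) : G.deg ≤ F.deg := by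
  induction h with
  | refl => exact le_rfl
  | addL _ ih => exact ih.trans (le_max_left _ _)
  | addR _ ih => exact ih.trans (le_max_right _ _)
  | mulL _ ih => exact ih.trans (Nat.le_add_right _ _)
  | mulR _ ih => exact ih.trans (Nat.le_add_left _ _)

/-- Subformulas mention fewer variables. [folklore] -/
theorem Sub.varsIn {G F : AForm σ} (h : Sub G F) {P : σ → Prop} (hF : F.VarsIn P) : G.VarsIn P := by
  induction h with
  | refl => exact hF
  | addL _ ih => exact ih hF.1
  | addR _ ih => exact ih hF.2
  | mulL _ ih => exact ih hF.1
  | mulR _ ih => exact ih hF.2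

/-- **Coefficients of the expansion are bounded by the weight** (indeed their absolute values sum
to at most the weight). [folklore] -/
theorem sum_natAbs_expand_le [DecidableEq σ] : ∀ F : AForm σ, (F.expand.map fun q => q.1.natAbs).sum ≤ F.wt
  | var _ => by simp [expand, wt]
  | cst c => by simp [expand, wt]
  | add F G => by
    rw [expand, List.map_append, List.sum_append, wt]
    exact add_le_add (sum_natAbs_expand_le F) (sum_natAbs_expand_le G)
  | mul F G => by
    rw [expand, wt]
    have key : ∀ (l₁ l₂ : List (ℤ × Finset σ)),
        ((l₁.flatMap fun p => l₂.map fun q => (p.1 * q.1, p.2 ∪ q.2)).map fun q => q.1.natAbs).sum =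
          (l₁.map fun p => p.1.natAbs).sum * (l₂.map fun q => q.1.natAbs).sum := by
      intro l₁ l₂
      induction l₁ with
      | nil => simp
      | cons p l₁ ih =>
        rw [List.flatMap_cons, List.map_append, List.sum_append, ih, List.map_cons, List.sum_cons, Nat.add_mul,
          List.map_map]
        congr 1
        rw [← List.sum_map_mul_left]
        congr 1
        exact List.map_congr_left fun q _ => by simp [Int.natAbs_mul]
    rw [key]
    exact Nat.mul_le_mul (sum_natAbs_expand_le F) (sum_natAbs_expand_le G)

/-- A single coefficient is bounded by the weight. [folklore] -/
theorem natAbs_le_wt_of_mem_expand [DecidableEq σ] (F : AForm σ) {q : ℤ × Finset σ} (hq : q ∈ F.expand) :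
    q.1.natAbs ≤ F.wt :=
  (List.single_le_sum (fun _ _ => Nat.zero_le _) _ (List.mem_map.2 ⟨q, hq, rfl⟩)).trans (sum_natAbs_expand_le F)

end AForm

namespace BT

variable {n : ℕ}

/-! ### Postfix strings: length, tokens, and the stacks of a run -/

/-- The postfix string has as many tokens as the formula has nodes. [folklore] -/
theorem length_rpn : ∀ F : AForm (V n), (rpn F).length = F.size
  | .var v => by rw [rpn_var]; rfl
  | .cst _ => rfl
  | .add F G => by simp [rpn, AForm.size, length_rpn F, length_rpn G, Nat.add_assoc]
  | .mul F G => by simp [rpn, AForm.size, length_rpn F, length_rpn G, Nat.add_assoc]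

/-- The tokens of a formula: variable tokens of its variables, constant tokens of its constants,
`+` and `×`. [folklore] -/
theorem mem_rpn {P : V n → Prop} {Q : ℤ → Prop} : ∀ {F : AForm (V n)}, F.VarsIn P → F.CstIn Q →
    ∀ t ∈ rpn F, (∃ v, P v ∧ t = varTok v) ∨ (∃ z, Q z ∧ t = Tok.cst z) ∨ t = Tok.add ∨ t = Tok.mul
  | .var v, hP, _, t, ht => by
    rw [rpn_var, List.mem_singleton] at ht
    exact Or.inl ⟨v, hP, ht⟩
  | .cst z, _, hQ, t, ht => by
    simp only [rpn, List.mem_singleton] at ht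
    exact Or.inr (Or.inl ⟨z, hQ, ht⟩)
  | .add F G, hP, hQ, t, ht => by
    simp only [rpn, List.mem_append, List.mem_singleton] at ht
    rcases ht with ht | ht | ht
    · exact mem_rpn hP.1 hQ.1 t ht
    · exact mem_rpn hP.2 hQ.2 t ht
    · exact Or.inr (Or.inr (Or.inl ht))
  | .mul F G, hP, hQ, t, ht => by
    simp only [rpn, List.mem_append, List.mem_singleton] at ht
    rcases ht with ht | ht | ht
    · exact mem_rpn hP.1 hQ.1 t ht
    · exact mem_rpn hP.2 hQ.2 t ht
    · exact Or.inr (Or.inr (Or.inr ht))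

/-- Prefixes of a concatenation. [folklore] -/
theorem prefix_append_cases {α : Type*} {tp l₁ l₂ : List α} (h : tp <+: l₁ ++ l₂) :
    tp <+: l₁ ∨ ∃ tp', tp = l₁ ++ tp' ∧ tp' <+: l₂ := by
  rcases List.prefix_or_prefix_of_prefix h (List.prefix_append l₁ l₂) with h1 | ⟨tp', rfl⟩
  · exact Or.inl h1
  · exact Or.inr ⟨tp', rfl, (List.prefix_append_right_inj l₁).1 h⟩

/-- **The stacks of a run are expansions of subformulas**: after any prefix of the tokens of `F`
(run on top of `st`), the stack is `es ++ st` with at most `|prefix|` new entries, each the keyed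
expansion of a subformula of `F`. [folklore] -/
theorem runToks_prefix : ∀ (F : AForm (V n)) (st : List KPoly) (tp : List Tok), tp <+: rpn F →
    ∃ es : List KPoly, runToks tp st = es ++ st ∧ es.length ≤ tp.length ∧
      ∀ e ∈ es, ∃ G, AForm.Sub G F ∧ e = expandK G := by
  intro F
  induction F with
  | var v =>
    intro st tp htp
    rw [rpn_var] at htp
    rcases List.prefix_cons_iff.1 htp with rfl | ⟨tp', rfl, htp'⟩
    · exact ⟨[], rfl, le_rfl, fun e he => by simp at he⟩
    · rw [List.prefix_nil] at htp'; subst htp'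
      refine ⟨[expandK (.var v)], ?_, by simp, fun e he => ⟨_, AForm.Sub.refl _, by simpa using he⟩⟩
      have := runToks_rpn (AForm.var v) [] st
      rw [rpn_var, List.append_nil] at this
      rw [this]; rfl
  | cst z =>
    intro st tp htp
    simp only [rpn] at htp
    rcases List.prefix_cons_iff.1 htp with rfl | ⟨tp', rfl, htp'⟩
    · exact ⟨[], rfl, le_rfl, fun e he => by simp at he⟩
    · rw [List.prefix_nil] at htp'; subst htp'
      refine ⟨[expandK (.cst z)], ?_, by simp, fun e he => ⟨_, AForm.Sub.refl _, by simpa using he⟩⟩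
      have := runToks_rpn (AForm.cst z : AForm (V n)) [] st
      rw [List.append_nil] at this
      exact this
  | add F G ihF ihG =>
    intro st tp htp
    simp only [rpn] at htp
    rcases prefix_append_cases htp with h | ⟨tp', rfl, h'⟩
    · obtain ⟨es, hrun, hlen, hes⟩ := ihF st tp h
      exact ⟨es, hrun, hlen, fun e he => by obtain ⟨G', hG', rfl⟩ := hes e he; exact ⟨G', hG'.addL, rfl⟩⟩
    · rcases prefix_append_cases h' with h'' | ⟨tp'', rfl, h''⟩
      · obtain ⟨es, hrun, hlen, hes⟩ := ihG (expandK F :: st) tp' h''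
        refine ⟨es ++ [expandK F], ?_, ?_, ?_⟩
        · rw [runToks_rpn, hrun]; simp
        · simp only [List.length_append, List.length_singleton]
          have hF1 : 1 ≤ (rpn F).length := by rw [length_rpn]; exact AForm.one_le_size F
          omega
        · intro e he
          rw [List.mem_append, List.mem_singleton] at he
          rcases he with he | rfl
          · obtain ⟨G', hG', rfl⟩ := hes e he; exact ⟨G', hG'.addR, rfl⟩
          · exact ⟨F, (AForm.Sub.refl F).addL, rfl⟩
      · rcases List.prefix_cons_iff.1 h'' with rfl | ⟨tp''', rfl, h'''⟩
        · obtain ⟨es, hrun, hlen, hes⟩ := ihG (expandK F :: st) (rpn G) (List.prefix_refl _)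
          refine ⟨es ++ [expandK F], ?_, ?_, ?_⟩
          · rw [List.append_nil, runToks_rpn, hrun]; simp
          · simp only [List.length_append, List.length_singleton, List.append_nil]
            have hF1 : 1 ≤ (rpn F).length := by rw [length_rpn]; exact AForm.one_le_size F
            omega
          · intro e he
            rw [List.mem_append, List.mem_singleton] at he
            rcases he with he | rfl
            · obtain ⟨G', hG', rfl⟩ := hes e he; exact ⟨G', hG'.addR, rfl⟩
            · exact ⟨F, (AForm.Sub.refl F).addL, rfl⟩
        · rw [List.prefix_nil] at h'''; subst h'''
          refine ⟨[expandK (.add F G)], ?_, by simp only [List.length_singleton, List.length_append]; omega,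
            fun e he => ⟨_, AForm.Sub.refl _, by simpa using he⟩⟩
          have := runToks_rpn (AForm.add F G) [] st
          rw [List.append_nil] at this
          exact this
  | mul F G ihF ihG =>
    intro st tp htp
    simp only [rpn] at htp
    rcases prefix_append_cases htp with h | ⟨tp', rfl, h'⟩
    · obtain ⟨es, hrun, hlen, hes⟩ := ihF st tp h
      exact ⟨es, hrun, hlen, fun e he => by obtain ⟨G', hG', rfl⟩ := hes e he; exact ⟨G', hG'.mulL, rfl⟩⟩
    · rcases prefix_append_cases h' with h'' | ⟨tp'', rfl, h''⟩
      · obtain ⟨es, hrun, hlen, hes⟩ := ihG (expandK F :: st) tp' h''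
        refine ⟨es ++ [expandK F], ?_, ?_, ?_⟩
        · rw [runToks_rpn, hrun]; simp
        · simp only [List.length_append, List.length_singleton]
          have hF1 : 1 ≤ (rpn F).length := by rw [length_rpn]; exact AForm.one_le_size F
          omega
        · intro e he
          rw [List.mem_append, List.mem_singleton] at he
          rcases he with he | rfl
          · obtain ⟨G', hG', rfl⟩ := hes e he; exact ⟨G', hG'.mulR, rfl⟩
          · exact ⟨F, (AForm.Sub.refl F).mulL, rfl⟩
      · rcases List.prefix_cons_iff.1 h'' with rfl | ⟨tp''', rfl, h'''⟩
        · obtain ⟨es, hrun, hlen, hes⟩ := ihG (expandK F :: st) (rpn G) (List.prefix_refl _)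
          refine ⟨es ++ [expandK F], ?_, ?_, ?_⟩
          · rw [List.append_nil, runToks_rpn, hrun]; simp
          · simp only [List.length_append, List.length_singleton, List.append_nil]
            have hF1 : 1 ≤ (rpn F).length := by rw [length_rpn]; exact AForm.one_le_size F
            omega
          · intro e he
            rw [List.mem_append, List.mem_singleton] at he
            rcases he with he | rfl
            · obtain ⟨G', hG', rfl⟩ := hes e he; exact ⟨G', hG'.mulR, rfl⟩
            · exact ⟨F, (AForm.Sub.refl F).mulL, rfl⟩
        · rw [List.prefix_nil] at h'''; subst h'''
          refine ⟨[expandK (.mul F G)], ?_, by simp only [List.length_singleton, List.length_append]; omega,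
            fun e he => ⟨_, AForm.Sub.refl _, by simpa using he⟩⟩
          have := runToks_rpn (AForm.mul F G) [] st
          rw [List.append_nil] at this
          exact this

/-! ### Copies, constants and sizes of the gate polynomials -/

namespace Setup

variable (K : Setup n)

/-- The variable belongs to copy `c` (inputs belong to every copy). [folklore] -/
def CopyIs (c : ℕ) : V n → Prop
  | .inl _ => True
  | .inr (c', _, _) => c' = c

/-- The variable belongs to a copy `< T`. [folklore] -/
def CopyLt (T : ℕ) : V n → Prop
  | .inl _ => True
  | .inr (c, _, _) => c < T

/-- Constants of absolute value at most `3`. [folklore] -/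
def Q3 (z : ℤ) : Prop := z.natAbs ≤ 3

/-- `Q3` is decidable. [folklore] -/
instance (z : ℤ) : Decidable (Q3 z) := inferInstanceAs (Decidable (_ ≤ _))

/-- Literals of copy `c` mention only copy `c`. [folklore] -/
theorem varsIn_litF_copy (c : ℕ) (w : Fin n ⊕ ℕ) (hw : OutOK K.C.gates.length w) : (K.litF c w).VarsIn (CopyIs c) :=
  (K.varsIn_litF c w hw).mono fun v hv => by
    rcases hv with ⟨i, rfl⟩ | ⟨j', rfl, -⟩
    · trivial
    · rfl

/-- **The defining polynomial of a variable of copy `c` mentions only copy `c`.** [folklore] -/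
theorem varsIn_FF'_copy (c j q : ℕ) : (K.FF' (.inr (c, j, q))).VarsIn (CopyIs c) := by
  have hlit : ∀ {j : ℕ} (hj : j < K.C.gates.length) (a : Fin (K.C.gates[j]).arity),
      (K.litF c ((K.C.gates[j]).args a)).VarsIn (CopyIs c) := fun hj a =>
    K.varsIn_litF_copy c _ fun m' hm' => (K.C.wf _ hj a m' hm').trans hj
  rcases q with _ | q
  · show (K.gateF' c j).VarsIn _
    unfold gateF'
    split_ifs with hj h1 h2
    · exact (K.varsIn_andF'_orF' c j _ (hlit hj)).1
    · exact (K.varsIn_andF'_orF' c j _ (hlit hj)).2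
    · exact K.varsIn_modF' c j fun p _ => rfl
    · trivial
  · show (K.auxFj' c j (q + 1)).VarsIn _
    unfold auxFj'
    split_ifs with hj
    · exact K.varsIn_auxF' c _ (hlit hj) (q + 1)
    · trivial

/-- Literals have constants `±1` only. [folklore] -/
theorem cstIn_litF (c : ℕ) (w : Fin n ⊕ ℕ) : (K.litF c w).CstIn Q3 := by
  cases w with
  | inl i => trivial
  | inr j =>
    simp only [litF]
    cases (srcLit K.C.gates j).1
    · cases (srcLit K.C.gates j).2 <;> trivial
    · refine AForm.CstIn.oneSub (by decide) (by decide) ?_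
      cases (srcLit K.C.gates j).2 <;> trivial

/-- **The defining polynomials have constants of absolute value `≤ 3`** (indeed `0, ±1`). [folklore] -/
theorem cstIn_FF' (v : V n) : (K.FF' v).CstIn Q3 := by
  have h0 : Q3 0 := by decide
  have h1 : Q3 1 := by decide
  have hm1 : Q3 (-1) := by decide
  rcases v with i | ⟨c, j, _ | q⟩
  · exact h0
  · show (K.gateF' c j).CstIn Q3
    unfold gateF'
    split_ifs with hj hc1 hc2
    · refine AForm.CstIn_prodL h1 fun F hF => ?_
      obtain ⟨t, -, rfl⟩ := List.mem_map.1 hF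
      refine AForm.CstIn.oneSub h1 hm1 (AForm.CstIn_sumL h0 fun G hG => ?_)
      obtain ⟨a, -, rfl⟩ := List.mem_map.1 hG
      exact AForm.CstIn.oneSub h1 hm1 (K.cstIn_litF c _)
    · refine AForm.CstIn.oneSub h1 hm1 (AForm.CstIn_prodL h1 fun F hF => ?_)
      obtain ⟨t, -, rfl⟩ := List.mem_map.1 hF
      refine AForm.CstIn.oneSub h1 hm1 (AForm.CstIn_sumL h0 fun G hG => ?_)
      obtain ⟨a, -, rfl⟩ := List.mem_map.1 hG
      exact K.cstIn_litF c _
    · refine AForm.CstIn.oneSub h1 hm1 (AForm.CstIn_prodL h1 fun F hF => ?_)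
      obtain ⟨p, -, rfl⟩ := List.mem_map.1 hF
      exact AForm.CstIn.oneSub h1 hm1 trivial
    · exact h0
  · show (K.auxFj' c j (q + 1)).CstIn Q3
    unfold auxFj'
    split_ifs with hj
    · refine AForm.CstIn.oneSub h1 hm1 (AForm.CstIn_prodL h1 fun F hF => ?_)
      obtain ⟨t, -, rfl⟩ := List.mem_map.1 hF
      refine AForm.CstIn.oneSub h1 hm1 (AForm.CstIn.pow h1 ?_ _)
      refine AForm.CstIn_sumL h0 fun G hG => ?_
      obtain ⟨A, -, rfl⟩ := List.mem_map.1 hG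
      refine AForm.CstIn_prodL h1 fun H hH => ?_
      obtain ⟨a, -, rfl⟩ := List.mem_map.1 hH
      exact K.cstIn_litF c _
    · exact h0

/-- Literals are small. [folklore] -/
theorem size_litF_le (c : ℕ) (w : Fin n ⊕ ℕ) : (K.litF c w).size ≤ 5 := by
  cases w with
  | inl i => exact Nat.le_of_lt (by show 1 < 5; norm_num)
  | inr j =>
    simp only [litF]
    cases (srcLit K.C.gates j).1
    · cases (srcLit K.C.gates j).2 <;> exact Nat.le_of_lt (by show 1 < 5; norm_num)
    · show (AForm.oneSub _).size ≤ 5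
      rw [AForm.size_oneSub]
      cases (srcLit K.C.gates j).2 <;> exact le_rfl

/-- The size bound of the defining polynomials (fan-in `≤ s`, `T₀` tests, modulus `m`). [folklore] -/
def SF (s T₀ m : ℕ) : ℕ :=
  T₀ * (10 * s + 6) + 5 + (6 * m + 11) + (m * (m * ((s + 1) ^ m * (6 * m + 2) + 2) + 6) + 5) + 1

/-- Size of the AND polynomial. [folklore] -/
theorem size_andF'_le (c j : ℕ) (g : Gate (Fin n)) : (K.andF' c j g).size ≤ K.T₀ * (10 * g.arity + 6) + 1 := by
  unfold andF'
  refine (AForm.size_prodL_le (S := 10 * g.arity + 5) fun F hF => ?_).trans (by rw [List.length_map, List.length_range])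
  obtain ⟨t, -, rfl⟩ := List.mem_map.1 hF
  rw [AForm.size_oneSub]
  have h := AForm.size_sumL_le (S := 9) (l := (K.selL c j g t).map fun a => (K.litF c (g.args a)).oneSub) fun G hG => by
    obtain ⟨a, -, rfl⟩ := List.mem_map.1 hG
    rw [AForm.size_oneSub]; have := K.size_litF_le c (g.args a); omega
  rw [List.length_map] at h
  have := K.length_selL_le c j g t
  nlinarith

/-- Size of the OR polynomial. [folklore] -/
theorem size_orF'_le (c j : ℕ) (g : Gate (Fin n)) : (K.orF' c j g).size ≤ K.T₀ * (10 * g.arity + 6) + 5 := by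
  unfold orF'
  rw [AForm.size_oneSub]
  have hprod := AForm.size_prodL_le (S := 10 * g.arity + 5)
    (l := (List.range K.T₀).map fun t => (AForm.sumL ((K.selL c j g t).map fun a => K.litF c (g.args a))).oneSub) fun F hF => by
      obtain ⟨t, -, rfl⟩ := List.mem_map.1 hF
      rw [AForm.size_oneSub]
      have h := AForm.size_sumL_le (S := 5) (l := (K.selL c j g t).map fun a => K.litF c (g.args a)) fun G hG => by
        obtain ⟨a, -, rfl⟩ := List.mem_map.1 hG
        exact K.size_litF_le c (g.args a)
      rw [List.length_map] at h
      have := K.length_selL_le c j g t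
      nlinarith
  rw [List.length_map, List.length_range] at hprod
  have : K.T₀ * (10 * g.arity + 5 + 1) = K.T₀ * (10 * g.arity + 6) := by ring
  omega

/-- Size of the MOD polynomial. [folklore] -/
theorem size_modF'_le (c j : ℕ) : (K.modF' c j).size ≤ 6 * K.m + 11 := by
  unfold modF'
  rw [AForm.size_oneSub]
  have hprod := AForm.size_prodL_le (S := 5)
    (l := (primesL K.m).map fun p => (AForm.var (.inr (c, j, p)) : AForm (V n)).oneSub) fun F hF => by
      obtain ⟨p, -, rfl⟩ := List.mem_map.1 hF
      rw [AForm.size_oneSub]; rfl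
  rw [List.length_map] at hprod
  have := length_primesL_le K.m
  nlinarith

/-- Size of `e_q` for `q ≤ m`. [folklore] -/
theorem size_esymF'_le (c : ℕ) (g : Gate (Fin n)) {q : ℕ} (hq : q ≤ K.m) :
    (K.esymF' c g q).size ≤ (g.arity + 1) ^ K.m * (6 * K.m + 2) + 1 := by
  unfold esymF'
  have hsum := AForm.size_sumL_le (S := 6 * K.m + 1)
    (l := ((List.finRange g.arity).sublistsLen q).map fun A => AForm.prodL (A.map fun a => K.litF c (g.args a))) fun F hF => by
      obtain ⟨A, hA, rfl⟩ := List.mem_map.1 hF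
      have hlen : A.length = q := (List.mem_sublistsLen.1 hA).2
      have h := AForm.size_prodL_le (S := 5) (l := A.map fun a => K.litF c (g.args a)) fun G hG => by
        obtain ⟨a, -, rfl⟩ := List.mem_map.1 hG
        exact K.size_litF_le c (g.args a)
      rw [List.length_map, hlen] at h
      nlinarith
  rw [List.length_map, List.length_sublistsLen, List.length_finRange] at hsum
  have hchoose : g.arity.choose q ≤ (g.arity + 1) ^ K.m :=
    (Nat.choose_le_pow _ _).trans ((Nat.pow_le_pow_left (Nat.le_succ _) _).trans (Nat.pow_le_pow_right (Nat.succ_pos _) hq))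
  calc _ ≤ g.arity.choose q * (6 * K.m + 1 + 1) + 1 := hsum
    _ ≤ (g.arity + 1) ^ K.m * (6 * K.m + 2) + 1 := by nlinarith

/-- Size of the auxiliary polynomial. [folklore] -/
theorem size_auxF'_le (c : ℕ) (g : Gate (Fin n)) (p : ℕ) :
    (K.auxF' c g p).size ≤ K.m * (K.m * ((g.arity + 1) ^ K.m * (6 * K.m + 2) + 2) + 6) + 5 := by
  unfold auxF'
  rw [AForm.size_oneSub]
  by_cases hp : p ∈ K.m.primeFactors
  · have he : K.m.factorization p ≤ K.m := (Nat.factorization_lt p K.m_ne_zero).le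
    have hp1 : p - 1 ≤ K.m := (Nat.sub_le p 1).trans (Nat.le_of_mem_primeFactors hp)
    set A := (g.arity + 1) ^ K.m * (6 * K.m + 2) with hA
    have hprod := AForm.size_prodL_le (S := K.m * (A + 2) + 5)
      (l := (List.range (K.m.factorization p)).map fun t => ((K.esymF' c g (p ^ t)).pow (p - 1)).oneSub) fun F hF => by
        obtain ⟨t, ht, rfl⟩ := List.mem_map.1 hF
        rw [List.mem_range] at ht
        rw [AForm.size_oneSub, AForm.size_pow]
        have hq : p ^ t ≤ K.m := K.pow_factorization_le hp ht.le
        have h1 := K.size_esymF'_le c g hq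
        rw [← hA] at h1
        calc (p - 1) * ((K.esymF' c g (p ^ t)).size + 1) + 1 + 4 ≤ K.m * (A + 1 + 1) + 1 + 4 :=
              by nlinarith
          _ = K.m * (A + 2) + 5 := by ring
    rw [List.length_map, List.length_range] at hprod
    have hmono : K.m.factorization p * (K.m * (A + 2) + 5 + 1) ≤ K.m * (K.m * (A + 2) + 6) := by
      rw [show K.m * (A + 2) + 5 + 1 = K.m * (A + 2) + 6 by ring]
      exact Nat.mul_le_mul_right _ he
    omega
  · have h0 : K.m.factorization p = 0 := Finsupp.notMem_support_iff.1 (by rwa [Nat.support_factorization])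
    rw [h0]
    simp [AForm.prodL, AForm.size]

/-- **Size of the defining polynomials**: `≤ SF s T₀ m` for fan-in `≤ s`. [folklore] -/
theorem size_FF'_le {s : ℕ} (hfan : K.C.maxFanIn ≤ s) (v : V n) : (K.FF' v).size ≤ SF s K.T₀ K.m := by
  have harity : ∀ {j : ℕ} (hj : j < K.C.gates.length), (K.C.gates[j]).arity ≤ s := fun hj =>
    (arity_le_maxFanIn K.C (List.getElem_mem hj)).trans hfan
  unfold SF
  rcases v with i | ⟨c, j, _ | q⟩
  · show (AForm.cst 0 : AForm (V n)).size ≤ _; simp [AForm.size]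
  · show (K.gateF' c j).size ≤ _
    unfold gateF'
    split_ifs with hj h1 h2
    · have := K.size_andF'_le c j (K.C.gates[j]); have := harity hj
      have : K.T₀ * (10 * (K.C.gates[j]).arity + 6) ≤ K.T₀ * (10 * s + 6) := Nat.mul_le_mul_left _ (by omega)
      omega
    · have := K.size_orF'_le c j (K.C.gates[j]); have := harity hj
      have : K.T₀ * (10 * (K.C.gates[j]).arity + 6) ≤ K.T₀ * (10 * s + 6) := Nat.mul_le_mul_left _ (by omega)
      omega
    · have := K.size_modF'_le c j; omega
    · simp [AForm.size]
  · show (K.auxFj' c j (q + 1)).size ≤ _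
    unfold auxFj'
    split_ifs with hj
    · have h := K.size_auxF'_le c (K.C.gates[j]) (q + 1)
      have ha := harity hj
      have hmono : ((K.C.gates[j]).arity + 1) ^ K.m * (6 * K.m + 2) ≤ (s + 1) ^ K.m * (6 * K.m + 2) :=
        Nat.mul_le_mul_right _ (Nat.pow_le_pow_left (by omega) _)
      have : K.m * (K.m * (((K.C.gates[j]).arity + 1) ^ K.m * (6 * K.m + 2) + 2) + 6) ≤
          K.m * (K.m * ((s + 1) ^ K.m * (6 * K.m + 2) + 2) + 6) :=
        Nat.mul_le_mul_left _ (Nat.add_le_add_right (Nat.mul_le_mul_left _ (Nat.add_le_add_right hmono _)) _)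
      omega
    · simp [AForm.size]

end Setup

/-! ### The genuine run: invariants of the stages -/

/-- Monotonicity of the stage exponents. [folklore] -/
theorem Eexp_mono (a e₀ : ℕ) {k k' : ℕ} (h : k ≤ k') : Setup.Eexp a e₀ k ≤ Setup.Eexp a e₀ k' := by
  induction h with
  | refl => exact le_rfl
  | step _ ih => exact ih.trans (by show _ ≤ 3 * _ + a + 5; omega)

/-- `e₀ ≤ Eexp a e₀ k`. [folklore] -/
theorem le_Eexp (a e₀ k : ℕ) : e₀ ≤ Setup.Eexp a e₀ k := Eexp_mono a e₀ (Nat.zero_le k)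

section genuine

variable {m : ℕ} (hm : 2 ≤ m) (C : Circuit (Fin n)) (hC : C.IsOver (accBasis m)) (d : ℕ)

/-- The formula of the genuine run after `k` stages, for `T` copies (the number of copies is kept
abstract in the structural lemmas and set to `vvT (sC C)` at the end). [folklore] -/
noncomputable def Rg (T k : ℕ) : AForm (V n) :=
  (setupOf m hm C hC).Rk T (lamC C) (4 * m + 10) 7 ((m + 1) * d) k

/-- The last stage exponent. [folklore] -/
def EL (d m : ℕ) : ℕ := Setup.Eexp (4 * m + 10) 7 ((m + 1) * d)

/-- `λ ≥ 2`. [folklore] -/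
theorem two_le_lamC : 2 ≤ lamC C := by unfold lamC; omega

/-- **The invariant after `k ≤ Lmax` stages** (`inv_explicit` with all hypotheses discharged). [folklore] -/
theorem inv_setupOf_k (hd : C.acDepth ≤ d) (k : ℕ) (hk : k ≤ (m + 1) * d) :
    (Rg hm C hC d (vvT (sC C)) k).VarsIn (fun v => (setupOf m hm C hC).Adm v ∧ (setupOf m hm C hC).level v ≤ (m + 1) * d - k) ∧
      (Rg hm C hC d (vvT (sC C)) k).deg ≤ lamC C ^ Setup.Eexp (4 * m + 10) 7 k ∧
      (Rg hm C hC d (vvT (sC C)) k).wt ≤ 2 ^ lamC C ^ Setup.Eexp (4 * m + 10) 7 k := by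
  have hsize : C.gates.length ≤ sC C := le_max_left _ _
  have hfan : C.maxFanIn ≤ sC C := le_max_right _ _
  obtain ⟨hDF, hWF⟩ := numeric_bounds_vv (sC C) hm
  obtain ⟨-, h2, h3, h4⟩ := (setupOf m hm C hC).inv_explicit (T := vvT (sC C)) (lam := lamC C) (a := 4 * m + 10) (e₀ := 7)
    (Lmax := (m + 1) * d) (DF := vvT₀ (sC C) + m ^ 3) (WF := (3 * sC C + 3) ^ (vvT₀ (sC C) + m ^ 3))
    (two_le_lamC C) (by norm_num) (two_mul_vvT_succ_le (sC C)) (fun x => vv_majority m C hsize hfan x)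
    (Nat.mul_le_mul_left _ hd) (fun v => (setupOf m hm C hC).deg_FF'_le v)
    (fun v => (setupOf m hm C hC).wt_FF'_le hfan (one_le_vvT₀ _) v) (Nat.one_le_pow _ _ (by omega)) hDF hWF k hk
  exact ⟨h2, h3, h4⟩

/-- **All variables of the stages belong to copies `< T`.** [folklore] -/
theorem varsIn_copy_Rg (T : ℕ) : ∀ k, k ≤ (m + 1) * d → (Rg hm C hC d T k).VarsIn (Setup.CopyLt T)
  | 0, _ => by
    refine AForm.VarsIn_sumL fun F hF => ?_
    obtain ⟨c, hc, rfl⟩ := List.mem_map.1 hF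
    rw [List.mem_range] at hc
    exact ((setupOf m hm C hC).varsIn_litF_copy c C.output C.wf_output).mono fun v hv => by
      rcases v with i | ⟨c', j, q⟩
      · trivial
      · show c' < _; rw [show c' = c from hv]; exact hc
  | k + 1, hk => by
    refine AForm.VarsIn_subst (fun v hv => ?_) (varsIn_copy_Rg T k (Nat.le_of_succ_le hk))
    refine AForm.VarsIn_collapseSubst' v (fun hb => ?_) hv
    rcases v with i | ⟨c, j, q⟩
    · exact absurd hb.2 (by show (0 : ℕ) ≠ (m + 1) * d - k; omega)
    · exact ((setupOf m hm C hC).varsIn_FF'_copy c j q).mono fun w hw => by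
        rcases w with i | ⟨c', j', q'⟩
        · trivial
        · show c' < _; rw [show c' = c from hw]; exact hv

/-- **All constants of the stages have absolute value `≤ 3`.** [folklore] -/
theorem cstIn_Rg (T : ℕ) : ∀ k, (Rg hm C hC d T k).CstIn Setup.Q3
  | 0 => AForm.CstIn_sumL (by decide) fun F hF => by
      obtain ⟨c, -, rfl⟩ := List.mem_map.1 hF
      exact (setupOf m hm C hC).cstIn_litF c C.output
  | k + 1 => AForm.CstIn_subst (fun v => AForm.CstIn_collapseSubst (by decide) (by decide) (by decide)
      (fun v => (setupOf m hm C hC).cstIn_FF' v) _ _ v) (cstIn_Rg T k)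

/-- The size multiplier of one stage. [folklore] -/
def MM : ℕ := 64 * lamC C ^ (3 * EL d m) * (m * (Setup.SF (sC C) (vvT₀ (sC C)) m + 1) + 3)

/-- `5^κ ≤ 64 λ^{3 EL}` for every stage `k ≤ Lmax`. [folklore] -/
theorem five_pow_kap_le {k : ℕ} (hk : k ≤ (m + 1) * d) :
    5 ^ Setup.kap (lamC C) (4 * m + 10) 7 k ≤ 64 * lamC C ^ (3 * EL d m) := by
  have h2 := two_le_lamC C
  have h1 : 1 ≤ lamC C := by omega
  have h17 : 1 ≤ Setup.Eexp (4 * m + 10) 7 k := le_trans (by norm_num) (le_Eexp (4 * m + 10) 7 k)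
  have h2E : 2 ≤ lamC C ^ Setup.Eexp (4 * m + 10) 7 k :=
    le_trans h2 (by simpa using Nat.pow_le_pow_right h1 h17)
  have hκ := Setup.two_pow_kap_le (lam := lamC C) (a := 4 * m + 10) (e₀ := 7) (k := k) h2E
  have hE : lamC C ^ Setup.Eexp (4 * m + 10) 7 k ≤ lamC C ^ EL d m := Nat.pow_le_pow_right h1 (Eexp_mono _ _ hk)
  set κ := Setup.kap (lamC C) (4 * m + 10) 7 k
  calc 5 ^ κ ≤ 8 ^ κ := Nat.pow_le_pow_left (by norm_num) _
    _ = (2 ^ 3) ^ κ := by norm_num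
    _ = (2 ^ κ) ^ 3 := by rw [← pow_mul, ← pow_mul, mul_comm]
    _ ≤ (4 * lamC C ^ EL d m) ^ 3 := Nat.pow_le_pow_left (hκ.trans (Nat.mul_le_mul_left _ hE)) 3
    _ = 64 * lamC C ^ (3 * EL d m) := by rw [mul_pow, ← pow_mul, mul_comm (EL d m)]; norm_num

/-- `MM ≥ 1`. [folklore] -/
theorem one_le_MM : 1 ≤ MM C d (m := m) :=
  Nat.one_le_iff_ne_zero.2 (Nat.mul_ne_zero (Nat.mul_ne_zero (by norm_num)
    (pow_ne_zero _ (by have := two_le_lamC C; omega))) (by omega))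

/-- The size of a stage substitution. [folklore] -/
theorem size_tau_le {k : ℕ} (hk : k ≤ (m + 1) * d) (v : V n) :
    ((setupOf m hm C hC).tau (lamC C) (4 * m + 10) 7 ((m + 1) * d) k v).size ≤ MM C d (m := m) := by
  have hfan : C.maxFanIn ≤ sC C := le_max_right _ _
  have hF : ∀ w, ((setupOf m hm C hC).FF' w).size ≤ Setup.SF (sC C) (vvT₀ (sC C)) m := fun w => by
    have := (setupOf m hm C hC).size_FF'_le hfan w
    simpa only [setupOf_m, setupOf_T₀] using this
  have hp : (setupOf m hm C hC).pSt ((m + 1) * d) k - 1 ≤ m := by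
    have := (setupOf m hm C hC).pSt_sub_one_le ((m + 1) * d) k
    simpa only [setupOf_m] using this
  have hs := AForm.size_collapseSubst_le (B := (setupOf m hm C hC).Batch ((m + 1) * d - k))
    (p := (setupOf m hm C hC).pSt ((m + 1) * d) k) (κ := Setup.kap (lamC C) (4 * m + 10) 7 k) hF v
  have h5 := five_pow_kap_le C d (m := m) hk
  set S := Setup.SF (sC C) (vvT₀ (sC C)) m
  have hP : ((setupOf m hm C hC).pSt ((m + 1) * d) k - 1) * (S + 1) + 3 ≤ m * (S + 1) + 3 :=
    Nat.add_le_add_right (Nat.mul_le_mul_right _ hp) _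
  unfold Setup.tau MM
  calc _ ≤ 5 ^ Setup.kap (lamC C) (4 * m + 10) 7 k * (((setupOf m hm C hC).pSt ((m + 1) * d) k - 1) * (S + 1) + 3) := by omega
    _ ≤ 64 * lamC C ^ (3 * EL d m) * (m * (S + 1) + 3) := Nat.mul_le_mul h5 hP

/-- **The size of the stages**: `size (Rk k) ≤ (6T + 1) · MM^k`. [folklore] -/
theorem size_Rg_le (T : ℕ) : ∀ k, k ≤ (m + 1) * d → (Rg hm C hC d T k).size ≤ (6 * T + 1) * MM C d (m := m) ^ k
  | 0, _ => by
    rw [pow_zero, mul_one]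
    have h := AForm.size_sumL_le (S := 5) (l := (List.range T).map fun c => (setupOf m hm C hC).litF c C.output)
      fun F hF => by
        obtain ⟨c, -, rfl⟩ := List.mem_map.1 hF
        exact (setupOf m hm C hC).size_litF_le c _
    rw [List.length_map, List.length_range] at h
    exact h.trans (by omega)
  | k + 1, hk => by
    have h := AForm.size_subst_le (one_le_MM C d (m := m)) (size_tau_le hm C hC d (Nat.le_of_succ_le hk)) (Rg hm C hC d T k)
    have ih := size_Rg_le T k (Nat.le_of_succ_le hk)
    calc (Rg hm C hC d T (k + 1)).size ≤ (Rg hm C hC d T k).size * MM C d := h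
      _ ≤ (6 * T + 1) * MM C d ^ k * MM C d := Nat.mul_le_mul_right _ ih
      _ = (6 * T + 1) * MM C d ^ (k + 1) := by rw [pow_succ, mul_assoc]

end genuine

/-! ### Lengths of codes -/

/-- Length of a token tuple code. [folklore] -/
theorem length_tupE (a b c e : ℕ) (z : ℤ) : (tupE (a, b, c, e, z)).length =
    2 * (natE a).length + 2 * (natE b).length + 2 * (natE c).length + 2 * (natE e).length + (intE z).length + 8 := by
  simp only [tupE, pairE_apply, length_boolPair]; omega

/-- **Length of a token code** with small constant: twice the digit lengths of its fields plus `20`. [folklore] -/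
theorem length_tokE_le (t : Tok) (hz : ∀ z, t = Tok.cst z → z.natAbs ≤ 3) :
    (tokE t).length ≤ 2 * ((natE (tokTuple t).2.1).length + (natE (tokTuple t).2.2.1).length +
      (natE (tokTuple t).2.2.2.1).length) + 20 := by
  have h0 : (intE 0).length ≤ 2 := by
    have := length_dpEnc_le_two_mul 0; simpa using this
  cases t with
  | inp i => show (tupE _).length ≤ _; rw [tokTuple, length_tupE]; simp; omega
  | gv c j q =>
    show (tupE _).length ≤ _; rw [tokTuple, length_tupE]
    have h1 := length_natE_le 1; simp; omega
  | cst z =>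
    show (tupE _).length ≤ _; rw [tokTuple, length_tupE]
    have h2 := length_natE_le 2
    have hz' := hz z rfl
    have h3 : (intE z).length ≤ 8 := by
      have := length_dpEnc_le_two_mul z
      have h4 := length_natE_le z.natAbs
      change (intE z).length ≤ 2 * (natE z.natAbs).length + 2 at this
      omega
    simp; omega
  | add => show (tupE _).length ≤ _; rw [tokTuple, length_tupE]; have := length_natE_le 3; simp; omega
  | mul => show (tupE _).length ≤ _; rw [tokTuple, length_tupE]; have := length_natE_le 4; simp; omega

/-- Length of a token string from a uniform token bound. [folklore] -/
theorem length_toksE_le {l : List Tok} {Bt : ℕ} (h : ∀ t ∈ l, (tokE t).length ≤ Bt) : (toksE l).length ≤ l.length * (2 * Bt + 2) := by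
  rw [toksE, length_rawE]
  have := List.sum_le_card_nsmul (l.map fun t => 2 * (tokE t).length + 2) (2 * Bt + 2) (fun x hx => by
    obtain ⟨t, ht, rfl⟩ := List.mem_map.1 hx; have := h t ht; omega)
  rwa [List.length_map, smul_eq_mul] at this

/-- `varTok` is injective. [folklore] -/
theorem varTok_injective : Function.Injective (varTok (n := n)) := by
  rintro (i | ⟨c, j, q⟩) (i' | ⟨c', j', q'⟩) h <;> simp only [varTok, Tok.inp.injEq, Tok.gv.injEq, reduceCtorEq] at h
  · exact congrArg Sum.inl (Fin.ext h)
  · obtain ⟨rfl, rfl, rfl⟩ := h; rfl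

/-- **Tokens of a genuine formula are short**: a formula whose variables are admissible and of copy
`< T` and whose constants have absolute value `≤ 3` has tokens of code length
`≤ 2 (|n| + |T| + |#gates| + m) + 20`. [folklore] -/
theorem length_tokE_le_of_mem_rpn (K : Setup n) {T : ℕ} {F : AForm (V n)}
    (hV : F.VarsIn (fun v => K.Adm v ∧ Setup.CopyLt T v)) (hQ : F.CstIn Setup.Q3) {t : Tok} (ht : t ∈ rpn F) :
    (tokE t).length ≤ 2 * ((natE n).length + (natE T).length + (natE K.C.gates.length).length + K.m) + 20 := by
  have htok := length_tokE_le t (fun z hz => by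
    rcases mem_rpn hV hQ t ht with ⟨v, -, rfl⟩ | ⟨z', hz', rfl⟩ | rfl | rfl
    · cases v <;> simp [varTok] at hz
    · cases hz; exact hz'
    · cases hz
    · cases hz)
  refine htok.trans ?_
  rcases mem_rpn hV hQ t ht with ⟨v, ⟨hadm, hcopy⟩, rfl⟩ | ⟨z', -, rfl⟩ | rfl | rfl
  · rcases v with i | ⟨c, j, q⟩
    · simp only [varTok, tokTuple, natE_zero, List.length_nil, add_zero]
      have := length_natE_mono i.2.le; omega
    · simp only [varTok, tokTuple]
      have hc : (natE c).length ≤ (natE T).length := length_natE_mono (le_of_lt hcopy)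
      rcases q with _ | q
      · have hj : (natE j).length ≤ (natE K.C.gates.length).length := length_natE_mono (le_of_lt hadm.1)
        simp only [natE_zero, List.length_nil]; omega
      · have hj : (natE j).length ≤ (natE K.C.gates.length).length := length_natE_mono (le_of_lt hadm.1)
        have hq : (natE (q + 1)).length ≤ K.m := (length_natE_le _).trans (Nat.le_of_mem_primeFactors hadm.2.2)
        omega
  · simp [tokTuple]
  · simp [tokTuple]
  · simp [tokTuple]

/-- **The size parameter, the input count and the number of gates are bounded by the code length.** [folklore] -/
theorem bounds_of_code (m : ℕ) (C : Circuit (Fin n)) :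
    sC C ≤ (encodeAccCircuit m C).length ∧ 2 * (natE n).length + 2 ≤ (encodeAccCircuit m C).length := by
  rw [encodeAccCircuit_eq_listE]
  have hlist : (listE natE (circuitCodeList m C)).length = 2 * (unE (circuitCodeList m C).length).length + 2 +
      (rawE natE (circuitCodeList m C)).length := by rw [listE, length_boolPair]
  have hraw := length_le_length_rawE natE (circuitCodeList m C)
  have hn : 2 * (natE n).length + 2 ≤ (rawE natE (circuitCodeList m C)).length :=
    length_item_le_length_rawE natE (by simp [circuitCodeList])
  have hflat : ∀ g ∈ C.gates, g.arity ≤ (C.gates.flatMap (gateCodeList m)).length ∧ 1 ≤ (gateCodeList m g).length := by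
    intro g hg
    have hlen : (gateCodeList m g).length = 2 + 2 * g.arity := by
      simp [gateCodeList, List.length_flatMap, Function.comp_def]; omega
    rw [List.length_flatMap]
    have := List.single_le_sum (l := C.gates.map fun a => (gateCodeList m a).length) (fun _ _ => Nat.zero_le _) _
      (List.mem_map.2 ⟨g, hg, rfl⟩)
    constructor <;> omega
  have hgates : C.gates.length ≤ (C.gates.flatMap (gateCodeList m)).length := by
    rw [List.length_flatMap]
    have := List.card_nsmul_le_sum (C.gates.map fun a => (gateCodeList m a).length) 1 (fun x hx => by
      obtain ⟨g, hg, rfl⟩ := List.mem_map.1 hx; exact (hflat g hg).2)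
    rwa [List.length_map, smul_eq_mul, mul_one] at this
  have hfan : C.maxFanIn ≤ (C.gates.flatMap (gateCodeList m)).length :=
    foldr_max_zero_le fun a ha => by obtain ⟨g, hg, rfl⟩ := List.mem_map.1 ha; exact (hflat g hg).1
  have hcl : (C.gates.flatMap (gateCodeList m)).length ≤ (circuitCodeList m C).length := by
    simp [circuitCodeList]; omega
  refine ⟨?_, by omega⟩
  exact max_le (by omega) (by omega)

/-! ### The two long fields: amplified tokens and stacks -/

section rawbounds

variable {m : ℕ}

/-- The token bound of the genuine run. [folklore] -/
def tbOf (m : ℕ) (C : Circuit (Fin n)) (T : ℕ) : ℕ :=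
  2 * ((natE n).length + (natE T).length + (natE C.gates.length).length + m) + 20

/-- A variable token of a formula with variables in `P` satisfies `P`. [folklore] -/
theorem of_varTok_mem_rpn {P : V n → Prop} {Q : ℤ → Prop} {F : AForm (V n)} (hV : F.VarsIn P) (hQ : F.CstIn Q)
    {v : V n} (ht : varTok v ∈ rpn F) : P v := by
  rcases mem_rpn hV hQ _ ht with ⟨v', hv', h⟩ | ⟨z, -, h⟩ | h | h
  · rw [varTok_injective h]; exact hv'
  · cases v <;> simp [varTok] at h
  · cases v <;> simp [varTok] at h
  · cases v <;> simp [varTok] at h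

/-- **The amplified token strings of the genuine run are at most `MM · (2 tb + 2)` long.** [folklore] -/
theorem toda_len_le (hm : 2 ≤ m) (C : Circuit (Fin n)) (hC : C.IsOver (accBasis m)) (d : ℕ) {k : ℕ}
    (hk : k < (m + 1) * d) {c j q : ℕ}
    (ht : Tok.gv c j q ∈ toksC m (sC C) (vvT₀ (sC C)) (vvT (sC C)) (lamC C) (4 * m + 10) 7 ((m + 1) * d)
      (gcodes m C) (depthsC (gcodes m C)) (srcTableC (gcodes m C)) (wireC C.output) k)
    (hb : admC m (gcodes m C) j q = true ∧ levC m (depthsC (gcodes m C)) j q = (m + 1) * d - k)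
    {i : ℕ} (hi : i ≤ Setup.kap (lamC C) (4 * m + 10) 7 k) :
    (toksE (todaToks^[i] (powToks (max 2 (stagePrimeC m ((m + 1) * d - k)) - 1)
      (ffToksC m (sC C) (vvT₀ (sC C)) (gcodes m C) (srcTableC (gcodes m C)) c j q)))).length ≤
      MM C d (m := m) * (2 * tbOf m C (vvT (sC C)) + 2) := by
  generalize hT : vvT (sC C) = T at ht ⊢
  set K := setupOf m hm C hC with hK
  rw [toksC_eq hm C hC k hk.le] at ht
  have hv : Setup.CopyLt T (.inr (c, j, q) : V n) :=
    of_varTok_mem_rpn (v := (.inr (c, j, q) : V n)) (varsIn_copy_Rg hm C hC d T k hk.le) (cstIn_Rg hm C hC d T k) ht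
  have hbatch : K.Batch ((m + 1) * d - k) (.inr (c, j, q)) := (batch_iff hm C hC _ c j q).2 hb
  have hlev : K.level (.inr (c, j, q)) ≠ 0 := by rw [hbatch.2]; omega
  -- the token string is `rpn` of the amplified Fermat power
  have hp : max 2 (stagePrimeC m ((m + 1) * d - k)) = K.pSt ((m + 1) * d) k := rfl
  rw [ffToksC_eq hm C hC, ← rpn_pow_eq, ← rpn_todaIter, hp]
  set G := AForm.todaIter i ((K.FF' (.inr (c, j, q))).pow (K.pSt ((m + 1) * d) k - 1)) with hG
  -- its tokens are short
  have hV : G.VarsIn (fun v => K.Adm v ∧ Setup.CopyLt T v) := by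
    refine (AForm.VarsIn.pow (AForm.VarsIn_and ?_ ?_) _).todaIter _
    · exact (K.varsIn_FF' hbatch.1 hlev).mono fun w hw => hw.1
    · exact (K.varsIn_FF'_copy c j q).mono fun w hw => by
        rcases w with i' | ⟨c', j', q'⟩
        · trivial
        · show c' < T; rw [show c' = c from hw]; exact hv
  have hQ : G.CstIn Setup.Q3 := ((K.cstIn_FF' _).pow (by decide) _).todaIter (by decide) (by decide) _
  have htb : ∀ t ∈ rpn G, (tokE t).length ≤ tbOf m C T := fun t htt => by
    have := length_tokE_le_of_mem_rpn K hV hQ htt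
    simpa only [tbOf, hK, setupOf_C, setupOf_m] using this
  refine (length_toksE_le htb).trans (Nat.mul_le_mul_right _ ?_)
  -- and it has at most `MM` of them
  rw [length_rpn]
  have hfan : C.maxFanIn ≤ sC C := le_max_right _ _
  have hF : (K.FF' (.inr (c, j, q))).size ≤ Setup.SF (sC C) (vvT₀ (sC C)) m := by
    have := K.size_FF'_le hfan (.inr (c, j, q)); simpa only [hK, setupOf_m, setupOf_T₀] using this
  have hpm : K.pSt ((m + 1) * d) k - 1 ≤ m := by
    have := K.pSt_sub_one_le ((m + 1) * d) k; simpa only [hK, setupOf_m] using this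
  have hs := AForm.size_todaIter ((K.FF' (.inr (c, j, q))).pow (K.pSt ((m + 1) * d) k - 1)) i
  rw [AForm.size_pow, ← hG] at hs
  have h5 : 5 ^ i ≤ 64 * lamC C ^ (3 * EL d m) := (Nat.pow_le_pow_right (by norm_num) hi).trans (five_pow_kap_le C d hk.le)
  have hP : (K.pSt ((m + 1) * d) k - 1) * ((K.FF' (.inr (c, j, q))).size + 1) + 1 + 2 ≤ m * (Setup.SF (sC C) (vvT₀ (sC C)) m + 1) + 3 := by
    have := Nat.mul_le_mul hpm (Nat.add_le_add_right hF 1); omega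
  unfold MM
  calc G.size ≤ 5 ^ i * ((K.pSt ((m + 1) * d) k - 1) * ((K.FF' (.inr (c, j, q))).size + 1) + 1 + 2) := by omega
    _ ≤ 64 * lamC C ^ (3 * EL d m) * (m * (Setup.SF (sC C) (vvT₀ (sC C)) m + 1) + 3) := Nat.mul_le_mul h5 hP

/-- The entry bound of the stacks of the genuine run. [folklore] -/
def PBOf (n D W : ℕ) : ℕ :=
  W * (2 * (2 * (2 * (D + 1) + 2) + 2 + D * (2 * ((natE n).length + 2) + 2)) + 2)

/-- Length of the code of a keyed expansion of a formula in the inputs with bounded weight and degree. [folklore] -/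
theorem length_kpolyE_expandK_le (K : Setup n) {G : AForm (V n)} {D W : ℕ} (hvars : G.VarsIn fun v => K.Adm v ∧ K.level v ≤ 0)
    (hdeg : G.deg ≤ D) (hwt : G.wt ≤ 2 ^ W) (hDW : W + 1 ≤ D + 1) : (kpolyE (expandK G)).length ≤ PBOf n D (2 ^ W) := by
  classical
  have hinp : G.VarsIn fun v => ∃ i, v = Sum.inl i := hvars.mono fun v hv => K.exists_inl_of_level hv.1 (Nat.le_zero.1 hv.2)
  unfold PBOf
  rw [kpolyE, expandK, length_rawE, List.map_map]
  have hcount : G.expand.length ≤ 2 ^ W := (AForm.length_expand_le_wt G).trans hwt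
  have hitem : ∀ q ∈ G.expand, 2 * (kmonoE (q.1, keys q.2)).length + 2 ≤
      2 * (2 * (2 * (D + 1) + 2) + 2 + D * (2 * ((natE n).length + 2) + 2)) + 2 := by
    intro q hq
    have hq' := AForm.forall_mem_expand_of_varsIn hinp q hq
    -- the coefficient
    have ha : (intE q.1).length ≤ 2 * (D + 1) + 2 := by
      have h1 := length_dpEnc_le_two_mul q.1
      have h2 : (natE q.1.natAbs).length ≤ W + 1 := by
        rw [length_natE]
        have h3 : q.1.natAbs ≤ 2 ^ W := (AForm.natAbs_le_wt_of_mem_expand G hq).trans hwt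
        calc Nat.size q.1.natAbs ≤ Nat.size (2 ^ W) := Nat.size_le_size h3
          _ = W + 1 := Nat.size_pow
      change (intE q.1).length ≤ 2 * (natE q.1.natAbs).length + 2 at h1
      omega
    -- the keys
    have hk : (rawE natE (keys q.2)).length ≤ D * (2 * ((natE n).length + 2) + 2) := by
      rw [length_rawE]
      have hlen : (keys q.2).length ≤ D := by
        rw [length_keys]; exact (AForm.card_le_deg_of_mem_expand G hq).trans hdeg
      have hkey : ∀ x ∈ (keys q.2).map (fun k => 2 * (natE k).length + 2), x ≤ 2 * ((natE n).length + 2) + 2 := by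
        intro x hx
        obtain ⟨k, hk, rfl⟩ := List.mem_map.1 hx
        rw [keys_eq_map_sort_toIn q.2 hq'] at hk
        obtain ⟨i, -, rfl⟩ := List.mem_map.1 hk
        have : (natE (2 * (i : ℕ))).length ≤ (natE n).length + 2 := by
          rw [length_natE, length_natE]
          calc Nat.size (2 * (i : ℕ)) ≤ Nat.size 2 + Nat.size (i : ℕ) := size_mul_le 2 i
            _ ≤ 2 + Nat.size n := add_le_add (by decide) (Nat.size_le_size i.2.le)
            _ = Nat.size n + 2 := add_comm _ _
        omega
      have := List.sum_le_card_nsmul _ _ hkey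
      rw [List.length_map, smul_eq_mul] at this
      exact this.trans (Nat.mul_le_mul_right _ hlen)
    have hmono : (kmonoE (q.1, keys q.2)).length = 2 * (intE q.1).length + 2 + (rawE natE (keys q.2)).length := by
      rw [kmonoE, pairE_apply, length_boolPair]
    omega
  have := List.sum_le_card_nsmul _ _ (fun x hx => by
    obtain ⟨q, hq, rfl⟩ := List.mem_map.1 hx
    exact hitem q hq)
  rw [List.length_map, smul_eq_mul] at this
  exact this.trans (Nat.mul_le_mul_right _ hcount)

/-- **The stacks of the genuine run are at most `(6T+1) · MM^{Lmax} · (2 PB + 2)` long.** [folklore] -/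
theorem stack_len_le (hm : 2 ≤ m) (C : Circuit (Fin n)) (hC : C.IsOver (accBasis m)) (d : ℕ) (hd : C.acDepth ≤ d)
    (tp : List Tok)
    (htp : tp <+: toksC m (sC C) (vvT₀ (sC C)) (vvT (sC C)) (lamC C) (4 * m + 10) 7 ((m + 1) * d)
      (gcodes m C) (depthsC (gcodes m C)) (srcTableC (gcodes m C)) (wireC C.output) ((m + 1) * d)) :
    (stackE (tp.foldl stackStep [])).length ≤ (6 * vvT (sC C) + 1) * MM C d (m := m) ^ ((m + 1) * d) *
      (2 * PBOf n (lamC C ^ EL d m) (2 ^ lamC C ^ EL d m) + 2) := by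
  obtain ⟨hvars, hdeg, hwt⟩ := inv_setupOf_k hm C hC d hd ((m + 1) * d) le_rfl
  rw [Nat.sub_self] at hvars
  have hsize := size_Rg_le hm C hC d (vvT (sC C)) ((m + 1) * d) le_rfl
  generalize hT : vvT (sC C) = T at htp hvars hdeg hwt hsize ⊢
  set K := setupOf m hm C hC with hK
  rw [toksC_eq hm C hC _ le_rfl] at htp
  obtain ⟨es, hrun, hlen, hes⟩ := runToks_prefix (Rg hm C hC d T ((m + 1) * d)) [] tp htp
  rw [show tp.foldl stackStep [] = runToks tp [] from rfl, hrun, List.append_nil, stackE, length_rawE]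
  have hcount : es.length ≤ (6 * T + 1) * MM C d (m := m) ^ ((m + 1) * d) :=
    hlen.trans ((htp.length_le.trans (by rw [length_rpn]; exact le_rfl)).trans hsize)
  have hitem : ∀ x ∈ es.map (fun e => 2 * (kpolyE e).length + 2), x ≤ 2 * PBOf n (lamC C ^ EL d m) (2 ^ lamC C ^ EL d m) + 2 := by
    intro x hx
    obtain ⟨e, he, rfl⟩ := List.mem_map.1 hx
    obtain ⟨G, hG, rfl⟩ := hes e he
    have := length_kpolyE_expandK_le K (D := lamC C ^ EL d m) (W := lamC C ^ EL d m) (hG.varsIn hvars)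
      (hG.deg_le.trans hdeg) (hG.wt_le.trans hwt) le_rfl
    omega
  have := List.sum_le_card_nsmul _ _ hitem
  rw [List.length_map, smul_eq_mul] at this
  exact this.trans (Nat.mul_le_mul_right _ hcount)

end rawbounds

/-! ### The master bound -/

section master

variable {m : ℕ}

/-- The exponent of the master bound `2^{(log₂ X + 2)^{Ebig}}`. [folklore] -/
def Ebig (d m : ℕ) : ℕ := 3 * EL d m + (m + 1) * d + 9 * m + 80

/-- Constants `≤ 256` are `≤ 2^{L^3}`. [folklore] -/
theorem const_le_qp3 {L : ℕ} (hL : 2 ≤ L) {c : ℕ} (hc : c ≤ 256) : c ≤ 2 ^ L ^ 3 :=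
  hc.trans (by
    calc (256 : ℕ) = 2 ^ 2 ^ 3 := by norm_num
      _ ≤ 2 ^ L ^ 3 := Nat.pow_le_pow_right two_pos (Nat.pow_le_pow_left hL 3))

/-- **The data of the genuine run fit every budget `B ≥ 2^{(log₂ X + 2)^{Ebig}}`**, `X` the length of
the circuit code: the hypothesis `CapFits` of the budget lemma `convCodeB_eq_convCode`.
[cite: Williams2014, Lemma 4.1 and Appendix A] -/
theorem capFits_of_le (hm : 2 ≤ m) (C : Circuit (Fin n)) (hC : C.IsOver (accBasis m)) (d : ℕ) (hd : C.acDepth ≤ d)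
    {B : ℕ} (hB : 2 ^ (Nat.log 2 (encodeAccCircuit m C).length + 2) ^ Ebig d m ≤ B) : CapFits d m B C := by
  -- the parameters
  set X := (encodeAccCircuit m C).length with hX
  set L := Nat.log 2 X + 2 with hLdef
  have hL : 2 ≤ L := by omega
  obtain ⟨hsX, hnX⟩ := bounds_of_code m C
  have hlamL : lamC C ≤ L := Nat.add_le_add_right (Nat.log_mono_right hsX) 2
  have hlam2 := two_le_lamC C
  have hlam1 : 1 ≤ lamC C := by omega
  have hlampow : ∀ r, lamC C ^ r ≤ L ^ r := fun r => Nat.pow_le_pow_left hlamL r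
  have hE : ∀ {x e : ℕ}, x ≤ 2 ^ L ^ e → e ≤ Ebig d m → x ≤ B := fun hx he => (qp_mono hL hx he).trans hB
  set E₁ := 8 * m + 60 with hE₁
  -- base quantities
  have hXq : X ≤ 2 ^ L ^ 1 := by
    rw [pow_one]; exact (Nat.lt_pow_succ_log_self one_lt_two X).le.trans (Nat.pow_le_pow_right two_pos (by omega))
  have hc : ∀ {c : ℕ}, c ≤ 256 → c ≤ 2 ^ L ^ E₁ := fun hc => qp_mono hL (const_le_qp3 hL hc) (by omega)
  have hsq : sC C ≤ 2 ^ L ^ E₁ := qp_mono hL (hsX.trans hXq) (by omega)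
  have h12 : 12 ≤ lamC C ^ 4 := le_trans (by norm_num) (Nat.pow_le_pow_left hlam2 4)
  have hT₀L : vvT₀ (sC C) ≤ L ^ 6 := by
    calc vvT₀ (sC C) ≤ 12 * lamC C ^ 2 := vvT₀_le _
      _ ≤ lamC C ^ 4 * lamC C ^ 2 := Nat.mul_le_mul_right _ h12
      _ = lamC C ^ 6 := by rw [← pow_add]
      _ ≤ L ^ 6 := hlampow 6
  have hT₀q : vvT₀ (sC C) ≤ 2 ^ L ^ E₁ := qp_mono hL (qp_of_le_Lpow hT₀L) (by omega)
  have hbitsL : vvBits (sC C) ≤ L ^ 7 := by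
    calc vvBits (sC C) ≤ 12 * lamC C ^ 3 := vvBits_le _
      _ ≤ lamC C ^ 4 * lamC C ^ 3 := Nat.mul_le_mul_right _ h12
      _ = lamC C ^ 7 := by rw [← pow_add]
      _ ≤ L ^ 7 := hlampow 7
  have hTq : vvT (sC C) ≤ 2 ^ L ^ 7 := qp_two_pow hbitsL
  have hTq' : vvT (sC C) ≤ 2 ^ L ^ E₁ := qp_mono hL hTq (by omega)
  have hnatT : (natE (vvT (sC C))).length ≤ 2 ^ L ^ E₁ := by
    have h1 : (natE (vvT (sC C))).length = vvBits (sC C) + 1 := by rw [length_natE, vvT, Nat.size_pow]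
    rw [h1]
    refine qp_mono hL (qp_of_le_Lpow (?_ : _ ≤ L ^ (7 + 1))) (by omega)
    have := Lpow_add_Lpow_le hL 7; have := one_le_Lpow hL 7; omega
  have hmq : m ≤ 2 ^ L ^ E₁ := qp_mono hL (qp_const hL m) (by omega)
  have hnLq : (natE n).length ≤ 2 ^ L ^ E₁ := qp_mono hL ((by omega : (natE n).length ≤ X).trans hXq) (by omega)
  have hgLq : (natE C.gates.length).length ≤ 2 ^ L ^ E₁ :=
    qp_mono hL ((((length_natE_le _).trans (le_max_left _ C.maxFanIn)).trans hsX).trans hXq) (by omega)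
  -- the token bound
  have htb : tbOf m C (vvT (sC C)) ≤ 2 ^ L ^ (E₁ + 5) := by
    unfold tbOf
    have h1 := qp_add hL hnLq hnatT
    have h2 := qp_add hL h1 (qp_mono hL hgLq (Nat.le_succ _))
    have h3 := qp_add hL h2 (qp_mono hL hmq (by omega))
    have h4 := qp_mul hL (qp_mono hL (hc (by norm_num : (2 : ℕ) ≤ 256)) (by omega)) h3
    exact qp_add hL h4 (qp_mono hL (hc (by norm_num : (20 : ℕ) ≤ 256)) (by omega))
  -- the size of the defining polynomials
  have hSF : Setup.SF (sC C) (vvT₀ (sC C)) m ≤ 2 ^ L ^ (E₁ + m + 10) := by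
    unfold Setup.SF
    have hA : vvT₀ (sC C) * (10 * sC C + 6) ≤ 2 ^ L ^ (E₁ + 3) := by
      have h1 := qp_mul hL (hc (by norm_num : (10 : ℕ) ≤ 256)) hsq
      have h2 := qp_add hL h1 (qp_mono hL (hc (by norm_num : (6 : ℕ) ≤ 256)) (by omega))
      exact qp_mul hL (qp_mono hL hT₀q (by omega)) h2
    have hBm : 6 * m + 11 ≤ 2 ^ L ^ (E₁ + 2) := by
      have h1 := qp_mul hL (hc (by norm_num : (6 : ℕ) ≤ 256)) hmq
      exact qp_add hL h1 (qp_mono hL (hc (by norm_num : (11 : ℕ) ≤ 256)) (by omega))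
    have hCm : m * (m * ((sC C + 1) ^ m * (6 * m + 2) + 2) + 6) + 5 ≤ 2 ^ L ^ (E₁ + m + 8) := by
      have h1 : sC C + 1 ≤ 2 ^ L ^ (E₁ + 1) := qp_add hL hsq (hc (by norm_num : (1 : ℕ) ≤ 256))
      have h2 : (sC C + 1) ^ m ≤ 2 ^ L ^ (E₁ + 1 + m) := qp_pow hL h1 m
      have h3 : 6 * m + 2 ≤ 2 ^ L ^ (E₁ + 2) := by
        have := qp_mul hL (hc (by norm_num : (6 : ℕ) ≤ 256)) hmq
        exact qp_add hL this (qp_mono hL (hc (by norm_num : (2 : ℕ) ≤ 256)) (by omega))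
      have h4 : (sC C + 1) ^ m * (6 * m + 2) ≤ 2 ^ L ^ (E₁ + m + 3) :=
        qp_mul hL (qp_mono hL h2 (by omega)) (qp_mono hL h3 (by omega))
      have h5 := qp_add hL h4 (qp_mono hL (hc (by norm_num : (2 : ℕ) ≤ 256)) (by omega))
      have h6 := qp_mul hL (qp_mono hL hmq (by omega)) h5
      have h7 := qp_add hL h6 (qp_mono hL (hc (by norm_num : (6 : ℕ) ≤ 256)) (by omega))
      have h8 := qp_mul hL (qp_mono hL hmq (by omega)) h7
      exact qp_add hL h8 (qp_mono hL (hc (by norm_num : (5 : ℕ) ≤ 256)) (by omega))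
    have h1 := qp_add hL hA (qp_mono hL (hc (by norm_num : (5 : ℕ) ≤ 256)) (by omega))
    have h2 := qp_add hL h1 (qp_mono hL hBm (by omega))
    have h3 := qp_add hL (qp_mono hL h2 (by omega : E₁ + 5 ≤ E₁ + m + 8)) hCm
    exact qp_add hL h3 (qp_mono hL (hc (by norm_num : (1 : ℕ) ≤ 256)) (by omega))
  -- the stage multiplier
  have hEL7 : 7 ≤ EL d m := le_Eexp _ _ _
  have hMM : MM C d (m := m) ≤ 2 ^ L ^ (3 * EL d m + E₁ + m + 13) := by
    unfold MM
    have h1 : lamC C ^ (3 * EL d m) ≤ 2 ^ L ^ (3 * EL d m) := qp_of_le_Lpow (hlampow _)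
    have h64 : 64 ≤ 2 ^ L ^ (3 * EL d m + E₁) := qp_mono hL (hc (by norm_num : (64 : ℕ) ≤ 256)) (by omega)
    have h1' : lamC C ^ (3 * EL d m) ≤ 2 ^ L ^ (3 * EL d m + E₁) := qp_mono hL h1 (by omega)
    have h2 : 64 * lamC C ^ (3 * EL d m) ≤ 2 ^ L ^ (3 * EL d m + E₁ + m + 12) := qp_mono hL (qp_mul hL h64 h1') (by omega)
    have h3 : Setup.SF (sC C) (vvT₀ (sC C)) m + 1 ≤ 2 ^ L ^ (E₁ + m + 11) :=
      qp_add hL hSF (qp_mono hL (hc (by norm_num : (1 : ℕ) ≤ 256)) (by omega))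
    have hm' : m ≤ 2 ^ L ^ (E₁ + m + 11) := qp_mono hL hmq (by omega)
    have h4 : m * (Setup.SF (sC C) (vvT₀ (sC C)) m + 1) ≤ 2 ^ L ^ (E₁ + m + 12) := qp_mul hL hm' h3
    have h3' : 3 ≤ 2 ^ L ^ (E₁ + m + 12) := qp_mono hL (hc (by norm_num : (3 : ℕ) ≤ 256)) (by omega)
    have h5 : m * (Setup.SF (sC C) (vvT₀ (sC C)) m + 1) + 3 ≤ 2 ^ L ^ (3 * EL d m + E₁ + m + 12) :=
      qp_mono hL (qp_add hL h4 h3') (by omega)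
    exact qp_mul hL h2 h5
  -- powers of `λ`
  have hpowEL : ∀ {k}, k ≤ (m + 1) * d → lamC C ^ Setup.Eexp (4 * m + 10) 7 k ≤ L ^ EL d m := fun hk =>
    (Nat.pow_le_pow_right hlam1 (Eexp_mono _ _ hk)).trans (hlampow _)
  have hLEL : L ^ EL d m ≤ 2 ^ L ^ EL d m := qp_of_le_Lpow le_rfl
  have h2EL : 2 ≤ 2 ^ L ^ EL d m := by
    calc (2 : ℕ) = 2 ^ 1 := rfl
      _ ≤ 2 ^ L ^ EL d m := Nat.pow_le_pow_right two_pos (one_le_Lpow hL _)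
  refine ⟨?_, ?_, ?_, ?_, ?_, ?_, ?_, ?_, ?_, ?_⟩
  · -- bits
    exact hE (qp_of_le_Lpow hbitsL) (by unfold Ebig; omega)
  · -- T
    exact hE hTq (by unfold Ebig; omega)
  · -- T₀
    exact hE hT₀q (by unfold Ebig; omega)
  · -- powers
    intro k hk
    exact hE ((hpowEL hk).trans hLEL) (by unfold Ebig; omega)
  · -- logarithms
    intro k hk
    have h1 : Nat.log 2 (lamC C ^ Setup.Eexp (4 * m + 10) 7 k + 2) ≤ L ^ EL d m + 2 :=
      (Nat.log_le_self 2 _).trans (Nat.add_le_add_right (hpowEL hk) 2)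
    exact hE (h1.trans (qp_add hL hLEL h2EL)) (by unfold Ebig; omega)
  · -- amplification depths
    intro k hk
    have h17 : 1 ≤ Setup.Eexp (4 * m + 10) 7 k := le_trans (by norm_num) (le_Eexp (4 * m + 10) 7 k)
    have h2E : 2 ≤ lamC C ^ Setup.Eexp (4 * m + 10) 7 k := le_trans hlam2 (by simpa using Nat.pow_le_pow_right hlam1 h17)
    have h1 := Setup.two_pow_kap_le (lam := lamC C) (a := 4 * m + 10) (e₀ := 7) (k := k) h2E
    have h4 : 4 ≤ 2 ^ L ^ EL d m := by
      have hL1 : 2 ≤ L ^ 1 := by rw [pow_one]; exact hL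
      have hL2 : L ^ 1 ≤ L ^ EL d m := Nat.pow_le_pow_right (by omega) (by omega)
      calc (4 : ℕ) = 2 ^ 2 := rfl
        _ ≤ 2 ^ L ^ EL d m := Nat.pow_le_pow_right two_pos (hL1.trans hL2)
    exact hE (h1.trans (qp_mul hL h4 ((hpowEL hk.le).trans hLEL))) (by unfold Ebig; omega)
  · -- amplified tokens
    intro k hk c j q ht hb i hi
    refine hE ((toda_len_le hm C hC d hk ht hb hi).trans ?_) (?_ : 3 * EL d m + E₁ + m + 13 + 1 ≤ Ebig d m)
    · have h2' : 2 ≤ 2 ^ L ^ (E₁ + 5) := qp_mono hL (hc (by norm_num : (2 : ℕ) ≤ 256)) (by omega)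
      have h1 : 2 * tbOf m C (vvT (sC C)) ≤ 2 ^ L ^ (E₁ + 6) := qp_mul hL h2' htb
      have h2'' : 2 ≤ 2 ^ L ^ (E₁ + 6) := qp_mono hL (hc (by norm_num : (2 : ℕ) ≤ 256)) (by omega)
      have h2 : 2 * tbOf m C (vvT (sC C)) + 2 ≤ 2 ^ L ^ (3 * EL d m + E₁ + m + 13) := qp_mono hL (qp_add hL h1 h2'') (by omega)
      exact qp_mul hL hMM h2
    · unfold Ebig; omega
  · -- stacks
    intro tp htp
    refine hE ((stack_len_le hm C hC d hd tp htp).trans ?_) (?_ : 3 * EL d m + E₁ + m + 13 + (m + 1) * d + 2 ≤ Ebig d m)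
    · have h6T : 6 * vvT (sC C) + 1 ≤ 2 ^ L ^ (E₁ + 2) := by
        have := qp_mul hL (hc (by norm_num : (6 : ℕ) ≤ 256)) hTq'
        exact qp_add hL this (qp_mono hL (hc (by norm_num : (1 : ℕ) ≤ 256)) (by omega))
      have hpow : MM C d (m := m) ^ ((m + 1) * d) ≤ 2 ^ L ^ (3 * EL d m + E₁ + m + 13 + (m + 1) * d) := qp_pow hL hMM _
      have hPB : PBOf n (lamC C ^ EL d m) (2 ^ lamC C ^ EL d m) ≤ 2 ^ L ^ (EL d m + E₁ + 9) := by
        unfold PBOf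
        set eD := EL d m + E₁ with heD
        have hD : lamC C ^ EL d m ≤ 2 ^ L ^ eD := qp_mono hL ((hlampow _).trans hLEL) (by omega)
        have hW : 2 ^ lamC C ^ EL d m ≤ 2 ^ L ^ eD := qp_mono hL (qp_two_pow (hlampow _)) (by omega)
        have hc' : ∀ {c : ℕ}, c ≤ 256 → ∀ e, eD ≤ e → c ≤ 2 ^ L ^ e := fun hcc e he => qp_mono hL (hc hcc) (by omega)
        have h1 : lamC C ^ EL d m + 1 ≤ 2 ^ L ^ (eD + 1) := qp_add hL hD (hc' (by norm_num) _ le_rfl)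
        have h2 : 2 * (lamC C ^ EL d m + 1) ≤ 2 ^ L ^ (eD + 2) := qp_mul hL (hc' (by norm_num) _ (by omega)) h1
        have h3 : 2 * (lamC C ^ EL d m + 1) + 2 ≤ 2 ^ L ^ (eD + 3) := qp_add hL h2 (hc' (by norm_num) _ (by omega))
        have h4 : 2 * (2 * (lamC C ^ EL d m + 1) + 2) ≤ 2 ^ L ^ (eD + 4) := qp_mul hL (hc' (by norm_num) _ (by omega)) h3
        have h5 : 2 * (2 * (lamC C ^ EL d m + 1) + 2) + 2 ≤ 2 ^ L ^ (eD + 5) := qp_add hL h4 (hc' (by norm_num) _ (by omega))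
        have h6 : (natE n).length + 2 ≤ 2 ^ L ^ (E₁ + 1) := qp_add hL hnLq (hc (by norm_num))
        have h7 : 2 * ((natE n).length + 2) ≤ 2 ^ L ^ (E₁ + 2) := qp_mul hL (qp_mono hL (hc (by norm_num : (2:ℕ) ≤ 256)) (by omega)) h6
        have h8 : 2 * ((natE n).length + 2) + 2 ≤ 2 ^ L ^ (E₁ + 3) := qp_add hL h7 (qp_mono hL (hc (by norm_num : (2:ℕ) ≤ 256)) (by omega))
        have h9 : lamC C ^ EL d m * (2 * ((natE n).length + 2) + 2) ≤ 2 ^ L ^ (eD + 4) :=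
          qp_mul hL (qp_mono hL hD (by omega)) (qp_mono hL h8 (by omega))
        have h10 := qp_add hL h5 (qp_mono hL h9 (by omega))
        have h11 := qp_mul hL (hc' (by norm_num : (2:ℕ) ≤ 256) _ (by omega : eD ≤ eD + 6)) h10
        have h12 := qp_add hL h11 (hc' (by norm_num : (2:ℕ) ≤ 256) _ (by omega))
        exact qp_mul hL (qp_mono hL hW (by omega)) h12
      have hPB2 : 2 * PBOf n (lamC C ^ EL d m) (2 ^ lamC C ^ EL d m) + 2 ≤ 2 ^ L ^ (EL d m + E₁ + 11) := by
        have := qp_mul hL (qp_mono hL (hc (by norm_num : (2:ℕ) ≤ 256)) (by omega)) hPB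
        exact qp_add hL this (qp_mono hL (hc (by norm_num : (2:ℕ) ≤ 256)) (by omega))
      have h6T' : 6 * vvT (sC C) + 1 ≤ 2 ^ L ^ (3 * EL d m + E₁ + m + 13 + (m + 1) * d) := qp_mono hL h6T (by omega)
      have h1 := qp_mul hL h6T' hpow
      have hPB2' : 2 * PBOf n (lamC C ^ EL d m) (2 ^ lamC C ^ EL d m) + 2 ≤
          2 ^ L ^ (3 * EL d m + E₁ + m + 13 + (m + 1) * d + 1) := qp_mono hL hPB2 (by omega)
      exact qp_mul hL h1 hPB2'
    · unfold Ebig; omega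
  · -- Kf
    unfold Setup.Kf Setup.Wb
    have h1 : 2 ^ lamC C ^ Setup.Eexp (4 * m + 10) 7 ((m + 1) * d) ≤ 2 ^ L ^ EL d m := qp_two_pow (hlampow _)
    have h2 := qp_mul hL (le_trans (by norm_num) h2EL : 2 ≤ 2 ^ L ^ EL d m) h1
    exact hE (qp_add hL h2 (qp_mono hL (le_trans (by norm_num) h2EL : 1 ≤ 2 ^ L ^ EL d m) (by omega)))
      (by unfold Ebig; omega)
  · -- size
    obtain ⟨-, -, hwt⟩ := inv_setupOf_k hm C hC d hd ((m + 1) * d) le_rfl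
    have hS := (setupOf m hm C hC).size_explicitSymPlus_le (T := vvT (sC C)) (a := 4 * m + 10) (e₀ := 7)
      (Lmax := (m + 1) * d) hlam2 hwt
    rw [toksC_eq hm C hC _ le_rfl, expandToks_rpn, ← length_termsOf]
    have hS' : (Setup.termsOf (Rg hm C hC d (vvT (sC C)) ((m + 1) * d))
        (Setup.Kf (lamC C) (4 * m + 10) 7 ((m + 1) * d))).length ≤ 2 ^ L ^ (EL d m + 2) :=
      hS.trans (Nat.pow_le_pow_right two_pos (hlampow _))
    exact hE (qp_add hL hS' (le_trans (by norm_num) (qp_mono hL h2EL (by omega)) : 1 ≤ 2 ^ L ^ (EL d m + 2)))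
      (by unfold Ebig; omega)

/-- **A quasi-polynomial pad suffices**: `2^{(log₂ X + 2)^E} ≤ c₁ X^{(log₂ X)^{e₁}} + c₁` for
`c₁ := 2^{3^E}`, `e₁ := 2E`. [folklore] -/
theorem pad_suffices (E : ℕ) : ∃ c₁ e₁ : ℕ, ∀ X : ℕ, 2 ^ (Nat.log 2 X + 2) ^ E ≤ c₁ * X ^ Nat.log 2 X ^ e₁ + c₁ := by
  refine ⟨2 ^ 3 ^ E, 2 * E, fun X => ?_⟩
  have hc1 : 1 ≤ 2 ^ 3 ^ E := Nat.one_le_two_pow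
  by_cases hX : 4 ≤ X
  · have hl : 2 ≤ Nat.log 2 X := Nat.le_log_of_pow_le one_lt_two (by simpa using hX)
    set l := Nat.log 2 X
    have h1 : (l + 2) ^ E ≤ l ^ (2 * E) := by
      calc (l + 2) ^ E ≤ (2 * l) ^ E := Nat.pow_le_pow_left (by omega) E
        _ = 2 ^ E * l ^ E := mul_pow 2 l E
        _ ≤ l ^ E * l ^ E := Nat.mul_le_mul_right _ (Nat.pow_le_pow_left hl E)
        _ = l ^ (2 * E) := by rw [← pow_add, two_mul]
    have h2 : 2 ^ (l + 2) ^ E ≤ X ^ l ^ (2 * E) :=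
      (Nat.pow_le_pow_right two_pos h1).trans (Nat.pow_le_pow_left (by omega) _)
    calc 2 ^ (l + 2) ^ E ≤ X ^ l ^ (2 * E) := h2
      _ ≤ 2 ^ 3 ^ E * X ^ l ^ (2 * E) := Nat.le_mul_of_pos_left _ hc1
      _ ≤ _ := Nat.le_add_right _ _
  · have hl : Nat.log 2 X ≤ 1 := by
      rcases Nat.eq_zero_or_pos X with rfl | hpos
      · simp
      · exact Nat.lt_succ_iff.1 (Nat.log_lt_of_lt_pow hpos.ne' (by omega))
    calc 2 ^ (Nat.log 2 X + 2) ^ E ≤ 2 ^ 3 ^ E := Nat.pow_le_pow_right two_pos (Nat.pow_le_pow_left (by omega) E)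
      _ ≤ _ := Nat.le_add_left _ _

end master

end BT

end Literature.Computability.Complexity
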